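import Summits.Schanuel.Schanuel.Theorems.RootDecomp1HSpineRigid

/-!
# RootDecomp1HSpine — continuation (RootDecomp1HSpineClear): §3 clearance without self-absorption (inf_towerSpan_eq_bot_of_mem, not_inTowerHull_of_rigid) + §3b transversality of ℚ-free n-cycles

Part of the six-file split (400-line rule) of lens 5's gen-11 node «CyclicSpine» = HOME/decomp-schanuel-lens-5/g11/Spine.lean
(sha256 ea4c5941…; ROUND 11 of route-Schanuel-RootDecomp1H, a THEOREM ROUND; `--supports stmt-Schanuel-30564`). All parts share the namespace
`Summit.Schanuel.Schanuel.Theorems.RootDecomp1HSpine` and the header block of the node; the module docstring of the first part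
(`RootDecomp1HSpineRigid`) describes the whole node. Sorry-free; standard axioms. Nothing here proves Schanuel; rung 0.
-/

set_option linter.dupNamespace false

noncomputable section

namespace Summit.Schanuel.Schanuel.Theorems.RootDecomp1HSpine

open Complex Set
open Literature.NumberTheory.Transcendental (exists_nsmul_mem_span_int mem_adjoin_of_mem_span_int SchanuelRank Khovanskii.ePD)
open Summit.Schanuel.Schanuel.Theses.RootDecomp1H (ProductSchanuel RelTowerSchanuel BridgeTransverse FinCS)
open Summit.Schanuel.Schanuel.Theorems.RootDecomp1HTowerCells (trdeg_adjoin_adjoin_eq trdeg_adjoin_union_le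
  trdeg_adjoin_range_le)
open Summit.Schanuel.Schanuel.Theorems.RootDecomp1HCurveHull
open Summit.Schanuel.Schanuel.Theorems.RootDecomp1HClearance (LowerRanks CounterEx InTowerHull)
open Summit.Schanuel.Schanuel.Theorems.RootDecomp1HWitness
open Summit.Schanuel.Schanuel.Theorems.RootDecomp1HGauge
open Summit.Schanuel.Schanuel.Theorems.RootDecomp1HCycles (ratCast_mem mem_closure_of_isAlgebraic_closure mem_closure_of_pair)

/-! ## 3. Clearance WITHOUT self-absorption: a rigid `ℚ`-free tuple lies off the tower hull -/

section clearance

/-- **RIGIDITY ⟹ CLEARANCE, absolute-membership form.**  Under Schanuel on the hull `𝓚`, a `ℚ`-free rigid (budget `s ≤ n − 2`)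
`n`-tuple `y ⊂ 𝓚` has span meeting the span of EVERY `ℚ`-free tower tuple trivially.  This is round 8's `inf_towerSpan_eq_bot`
with the hypothesis «`y` self-absorbing» REPLACED by «`y ⊂ 𝓚`» — which is all its proof used, and which holds for free when `y`
lies in the tower hull.  (Induction on the tower: at the first storey meeting `span y`, the free family `(prefix, y) ⊂ 𝓚` has
`trdeg ≥ N + n` by Schanuel on `𝓚`, but `≤ (N + 1) + s` by rigidity along the meeting direction.) -/
theorem inf_towerSpan_eq_bot_of_mem (hS : SchanuelOn curveHull) {n s : ℕ} (hsn : s + 2 ≤ n) {y : Fin n → ℂ}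
    (hy : LinearIndependent ℚ y) (hR : Rigid y s) (hyK : ∀ j, y j ∈ curveHull) :
    ∀ (N : ℕ) (b : Fin N → ℂ), LinearIndependent ℚ b → TowerTuple b →
      ∀ v ∈ Submodule.span ℚ (range y), v ∈ Submodule.span ℚ (range b) → v = 0 := by
  intro N
  induction N with
  | zero =>
    intro b _ _ v _ hvb
    rw [Set.range_eq_empty b, Submodule.span_empty] at hvb
    exact (Submodule.mem_bot ℚ).1 hvb
  | succ N ih =>
    intro b hb htow v hvy hvb
    by_contra hv0
    set b' : Fin N → ℂ := b ∘ Fin.castSucc with hb'def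
    have hb' : LinearIndependent ℚ b' := hb.comp _ (Fin.castSucc_injective N)
    have hb'tow : TowerTuple b' := towerTuple_castSucc htow
    have hdisj : Disjoint (Submodule.span ℚ (range b')) (Submodule.span ℚ (range y)) := by
      rw [Submodule.disjoint_def]
      intro x hxb' hxy
      exact ih b' hb' hb'tow x hxy hxb'
    have hbK : ∀ i, b i ∈ curveHull :=
      tower_mem_of_isCurveClosed curveHull isCurveClosed_curveHull hS (N + 1) b hb htow
    have hsum : LinearIndependent ℚ (Sum.elim b' y) := hb'.sum_type hy hdisj
    let e : Fin N ⊕ Fin n ≃ Fin (N + n) := finSumFinEquiv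
    set T : Fin (N + n) → ℂ := Sum.elim b' y ∘ e.symm with hTdef
    have hTli : LinearIndependent ℚ T := hsum.comp _ e.symm.injective
    have hmemK : ∀ w : Fin N ⊕ Fin n, Sum.elim b' y w ∈ curveHull := by
      rintro (i | j)
      · exact hbK _
      · exact hyK j
    have hTK : ∀ t, T t ∈ curveHull := fun t => hmemK (e.symm t)
    have hlow := hS (N + n) T hTK hTli
    obtain ⟨x, hx⟩ := hR v hvy hv0
    set A : Set ℂ := range b ∪ range (cexp ∘ b) with hAdef
    have hA1 : Algebra.trdeg ℚ ↥(IntermediateField.adjoin ℚ (A ∪ {cexp v})) =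
        Algebra.trdeg ℚ ↥(IntermediateField.adjoin ℚ A) :=
      trdeg_adjoin_union_eq_of_isAlgebraic_adjoin A {cexp v} fun w hw => by
        rw [Set.mem_singleton_iff.1 hw]; exact isAlgebraic_exp_of_mem_span b hvb
    have hA2 : Algebra.trdeg ℚ ↥(IntermediateField.adjoin ℚ ((A ∪ {cexp v}) ∪ range x)) ≤
        Algebra.trdeg ℚ ↥(IntermediateField.adjoin ℚ (A ∪ {cexp v})) + (s : Cardinal) :=
      (trdeg_adjoin_union_le _ _).trans (add_le_add le_rfl (trdeg_adjoin_range_le (F := ℚ) (E := ℂ) x))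
    have hvA : v ∈ IntermediateField.adjoin ℚ ((A ∪ {cexp v}) ∪ range x) :=
      IntermediateField.adjoin.mono ℚ _ _ (Set.subset_union_left.trans Set.subset_union_left)
        (mem_adjoin_of_mem_span b hvb)
    have hevA : cexp v ∈ IntermediateField.adjoin ℚ ((A ∪ {cexp v}) ∪ range x) :=
      IntermediateField.subset_adjoin ℚ _ (Or.inl (Or.inr rfl))
    have hxA : ∀ i, x i ∈ IntermediateField.adjoin ℚ ((A ∪ {cexp v}) ∪ range x) := fun i =>
      IntermediateField.subset_adjoin ℚ _ (Or.inr ⟨i, rfl⟩)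
    have hA3 : Algebra.trdeg ℚ ↥(IntermediateField.adjoin ℚ (((A ∪ {cexp v}) ∪ range x) ∪ (range y ∪ range (cexp ∘ y)))) =
        Algebra.trdeg ℚ ↥(IntermediateField.adjoin ℚ ((A ∪ {cexp v}) ∪ range x)) :=
      trdeg_adjoin_union_eq_of_isAlgebraic_adjoin _ _ fun w hw => hx _ hvA hevA hxA w hw
    have hsub : range T ∪ range (cexp ∘ T) ⊆ ((A ∪ {cexp v}) ∪ range x) ∪ (range y ∪ range (cexp ∘ y)) := by
      rintro z (⟨t, rfl⟩ | ⟨t, rfl⟩)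
      · simp only [hTdef, Function.comp_apply]
        rcases e.symm t with i | j
        · exact Or.inl (Or.inl (Or.inl (Or.inl ⟨Fin.castSucc i, rfl⟩)))
        · exact Or.inr (Or.inl ⟨j, rfl⟩)
      · simp only [hTdef, Function.comp_apply]
        rcases e.symm t with i | j
        · exact Or.inl (Or.inl (Or.inl (Or.inr ⟨Fin.castSucc i, rfl⟩)))
        · exact Or.inr (Or.inr ⟨j, rfl⟩)
    have hup := Literature.NumberTheory.Transcendental.OneMotiveToric.trdeg_mono (IntermediateField.adjoin.mono ℚ _ _ hsub)
    have hAN : Algebra.trdeg ℚ ↥(IntermediateField.adjoin ℚ A) ≤ ((N + 1 : ℕ) : Cardinal) := trdeg_le_of_towerTuple htow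
    have hfinal : ((N + n : ℕ) : Cardinal) ≤ ((N + 1 : ℕ) : Cardinal) + (s : Cardinal) :=
      calc ((N + n : ℕ) : Cardinal) ≤ _ := hlow
        _ ≤ _ := hup
        _ = _ := hA3
        _ ≤ _ := hA2
        _ = Algebra.trdeg ℚ ↥(IntermediateField.adjoin ℚ A) + (s : Cardinal) := by rw [hA1]
        _ ≤ ((N + 1 : ℕ) : Cardinal) + (s : Cardinal) := add_le_add hAN le_rfl
    norm_cast at hfinal
    omega

/-- **A RIGID `ℚ`-FREE TUPLE LIES OFF THE TOWER HULL** (budget `s ≤ n − 2`), under Schanuel on `𝓚` — no self-absorption needed: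
if `y ⊂ span_ℚ b` for a `ℚ`-free tower `b`, then `b ⊂ 𝓚` puts `y ⊂ 𝓚`, and the previous theorem makes `span y ∩ span b = 0 ∋ y_0`. -/
theorem not_inTowerHull_of_rigid (hS : SchanuelOn curveHull) {n s : ℕ} (hsn : s + 2 ≤ n) {y : Fin n → ℂ}
    (hy : LinearIndependent ℚ y) (hR : Rigid y s) : ¬ InTowerHull y := by
  rintro ⟨N, b, hb, htow, hmem⟩
  have hbK : ∀ i, b i ∈ curveHull := tower_mem_of_isCurveClosed curveHull isCurveClosed_curveHull hS N b hb htow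
  have hyK : ∀ j, y j ∈ curveHull := fun j => (Submodule.span_le.2 (Set.range_subset_iff.2 hbK)) (hmem j)
  have j0 : Fin n := ⟨0, by omega⟩
  exact hy.ne_zero j0
    (inf_towerSpan_eq_bot_of_mem hS hsn hy hR hyK N b hb htow (y j0) (Submodule.subset_span ⟨j0, rfl⟩) (hmem j0))

end clearance

/-! ## 3b. Transversality of `ℚ`-free `n`-cycles -/

section transversal

variable {n : ℕ} [NeZero n] {r c : Fin n → ℚ} {y : Fin n → ℂ}

/-- **A `ℚ`-FREE `n`-CYCLE (`n ≥ 3`) LIES OFF THE TOWER HULL** (the fourth inline hypothesis of `BridgeTransverse`), under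
Schanuel on `𝓚`. -/
theorem not_inTowerHull_cycleN (h : IsCycleN r c y) (hn : 3 ≤ n) (hS : SchanuelOn curveHull) (hy : LinearIndependent ℚ y) :
    ¬ InTowerHull y :=
  not_inTowerHull_of_rigid hS (s := n - 2) (by omega) hy (rigid_cycleN h hn)

/-- The same under the route's structural binders `ProductSchanuel ∧ RelTowerSchanuel`. -/
theorem not_inTowerHull_cycleN_of_structural (h : IsCycleN r c y) (hn : 3 ≤ n) (hPS : ProductSchanuel)
    (hRT : RelTowerSchanuel) (hy : LinearIndependent ℚ y) : ¬ InTowerHull y :=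
  not_inTowerHull_cycleN h hn (schanuelOn_curveHull_of_structural hPS hRT) hy

/-- The same under Schanuel's conjecture itself. -/
theorem not_inTowerHull_cycleN_of_schanuel (h : IsCycleN r c y) (hn : 3 ≤ n) (hSC : _root_.Schanuel)
    (hy : LinearIndependent ℚ y) : ¬ InTowerHull y :=
  not_inTowerHull_cycleN h hn (schanuelOn_curveHull_of_schanuel hSC) hy

/-- If a `ℚ`-free `n`-cycle sat inside `𝓚` its span would meet every tower span trivially; in particular a `ℚ`-free `n`-cycle
is never contained in the hull `𝓚` (under Schanuel on `𝓚`). -/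
theorem cycleN_not_subset_curveHull (h : IsCycleN r c y) (hn : 3 ≤ n) (hS : SchanuelOn curveHull)
    (hy : LinearIndependent ℚ y) : ¬ (∀ j, y j ∈ curveHull) := by
  intro hyK
  have hTS : TowerSchanuel := towerSchanuel_iff_schanuelOn_curveHull.mpr hS
  have j0 : Fin n := ⟨0, by omega⟩
  have hv' : y j0 ∈ towerHullSet := by rw [towerHullSet_eq_curveHull hTS]; exact hyK j0
  obtain ⟨N, b, hb, htow, hvb⟩ := hv'
  exact hy.ne_zero j0 (inf_towerSpan_eq_bot_of_mem hS (s := n - 2) (by omega) hy (rigid_cycleN h hn) hyK N b hb htow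
    (y j0) (Submodule.subset_span ⟨j0, rfl⟩) hvb)

end transversal

end Summit.Schanuel.Schanuel.Theorems.RootDecomp1HSpine
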